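import Literature.AlgebraicGeometry.ShimuraVarieties.UnitaryShimuraCurveEmbeddingInjectiveDepth
import Literature.AlgebraicGeometry.ShimuraVarieties.UnitaryShimuraCurveEmbeddingClosed
import Literature.AlgebraicGeometry.ShimuraVarieties.UnitaryShimuraCurveEmbeddingWitnessReduction
import Literature.AlgebraicGeometry.ShimuraVarieties.UnitaryShimuraCurveEmbeddingWitnessFinite
import Literature.NumberTheory.Automorphic.UnitaryGroupLevelBasis
import Literature.NumberTheory.Automorphic.UnitaryNegConeCocompactRankTwo
import HarnessLib

/-!
# Injectivity of the sub-ball embedding `Sh_{K⋆}(U(J⋆), 𝔻)(ℂ) → Sh_K(U(H), 𝔹²)(ℂ)` — the COFINAL COROLLARY at the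
# `B`-adapted principal congruence levels ([Del71] Prop. 1.15 for `U(W^⊥) ↪ U(V)`; road (ii) leaf R2-1-inj, (F-INJ) part 3, §9)

Topic `AlgebraicGeometry/ShimuraVarieties`, namespace `…UnitaryCanonicalModel` (continuation of (F-INJ) parts 1–2).  THEOREMS ONLY
(no definition, no instance, no named fact, no `sorry`; books 0).  Cell `hodgecm-mathlib` (D-0151), road (ii) leaf R2-1-inj
(census `A-provers/A-p15/g7/CENSUS-R2-1-inj.A-p15g7.md`; A-plan2 dossier A.15 ADD.10/13).  HC_CM is proved only modulo the 7 printed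
citations until rung 0 closes; nothing here is in a registered cone.

The family of levels is CONCRETE: the `B`-ADAPTED principal congruence levels
`K_B(n) := finAdelicCongr B (K_{J⋆ ⊕ J⊥}(n𝓞_L)) ≤ U(H)(𝔸_f)` (★ `finCongruenceLevel` transported along ★ `finAdelicCongr`; census
falsifier (i) as resolved by (F-A): the centre part of a `W^⊥`-stabiliser dies at `K_B(n)`, `3 ∣ n`), taken at depths `n = (m+3)!`
(`m : ℕ`): antitone (`finCongruenceLevel_mono`), open and compact (★ `isOpen/isCompact_finCongruenceLevel`), shrinking to `1` (★
`exists_finCongruenceLevel_span_subset`).  With `K⋆(m) := φGS⁻¹(K_B((m+3)!))` (the TRACE level, compact because ★ `φGS` is a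
closed embedding) the §8 assembly gives: **for all `m ≥ m₀`, `embPoints : Sh_{K⋆(m)}(U(J⋆),𝔻)(ℂ) → Sh_{K_B((m+3)!)}(U(H),𝔹²)(ℂ)` is
injective** (`ShimuraSetGS.embPoints_injective_cofinal`), GRANTED the four routed inputs in the exact shapes their writers posted:
(S1) finite double-coset representatives (A-p04 `exists_finset_doubleCoset_reps`), (S2) compact fundamental sets for `Γ⋆(K⋆;g)`
on the cone (A-p19), (S3) finiteness of witnesses between compact sets (★ A-p09 `finite_setOf_witness_meeting` p694655), (F-A) the
case-(A) closer at `B`-adapted depth `3 ≤ n` (A-p02 `exists_eq_embRational_of_mulVec_frameEmb_of_mem_level_cm`) — (S1) ★ p694733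
and (S3) ★ p694655 are CONSUMED BY NAME; (S2) ★ p698127 `exists_isCompact_negCone_fundamental_conj` (A-p19) likewise, given a `(1,1)`-frame
`hTstar` of `J⋆^τ`; (F-A) is the HYPOTHESIS `hFA` until its §6 head lands.

References: [Deligne1971TravauxShimura] Prop. 1.15 + proof pp. 132–133; [Milne2005ShimuraVarieties] Lemma 5.13 p. 57, Thm. 5.16;
[PlatonovRapinchuk1994] §5.1 (congruence subgroups as a basis of neighbourhoods of `1`).
-/

noncomputable section

open Function MulAction Matrix NumberField IsDedekindDomain
open scoped Matrix ComplexOrder Pointwise Topology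
open Literature.Geometry.ComplexHyperbolic Literature.Geometry.ComplexHyperbolic.BallModel
open Literature.NumberTheory.Automorphic Literature.NumberTheory.Automorphic.UnitaryGroup

namespace Literature.AlgebraicGeometry.ShimuraVarieties

namespace UnitaryCanonicalModel

variable {L : Type} [Field L] [NumberField L] [IsCMField L] {H : Matrix (Fin 3) (Fin 3) L} {τ : L →+* ℂ} {T : GL (Fin 3) ℂ}

section Cofinal

variable (L H τ T) (hT : formCongr (starRingEnd ℂ) T (H.map τ) = BallModel.J)
  (Jstar : Matrix (Fin 2) (Fin 2) L) (Jperp : Matrix (Fin 1) (Fin 1) L) (B : GL (Fin 3) L) {a : L} (ha : a ≠ 0)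
  (hB : formCongr ((IsCMField.complexConj L : L ≃ₐ[↥(maximalRealSubfield L)] L) : L →+* L) B (a • H) =
    finSum 2 1 Jstar Jperp)
  (hτa : 0 < (τ a).re) (hτa' : (τ a).im = 0)

/-! ### §9a. The `B`-adapted principal levels `K_B((m+3)!)`: open, compact, closed, antitone, shrinking to `1` -/

omit [IsCMField L] in
/-- `((m+3)! : 𝓞 L) ≠ 0`, so the level ideal is nonzero. [folklore] -/
private theorem span_factorial_ne_zero (m : ℕ) : Ideal.span {(((m + 3).factorial : ℕ) : 𝓞 L)} ≠ 0 := by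
  rw [Ne, Ideal.zero_eq_bot, Ideal.span_singleton_eq_bot, Nat.cast_eq_zero]
  exact Nat.factorial_ne_zero _

/-- `K_B((m+3)!)` is OPEN. [cite: PlatonovRapinchuk1994, §5.1] -/
theorem isOpen_levelB (m : ℕ) :
    IsOpen (((finCongruenceLevel (↥(maximalRealSubfield L)) L (IsCMField.complexConj L) 3 (finSum 2 1 Jstar Jperp)
        (Ideal.span {(((m + 3).factorial : ℕ) : 𝓞 L)})).map (finAdelicCongr (↥(maximalRealSubfield L)) L (IsCMField.complexConj L) B ha hB).toMonoidHom) : Set ↥(finAdelic (↥(maximalRealSubfield L)) L (IsCMField.complexConj L) 3 H)) := by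
  rw [Subgroup.coe_map]
  exact (finAdelicCongr (↥(maximalRealSubfield L)) L (IsCMField.complexConj L) B ha hB).isOpenMap _
    (isOpen_finCongruenceLevel _ L _ 3 _ (span_factorial_ne_zero L m))

/-- `K_B((m+3)!)` is COMPACT. [cite: PlatonovRapinchuk1994, §5.1] -/
theorem isCompact_levelB (m : ℕ) :
    IsCompact (((finCongruenceLevel (↥(maximalRealSubfield L)) L (IsCMField.complexConj L) 3 (finSum 2 1 Jstar Jperp)
        (Ideal.span {(((m + 3).factorial : ℕ) : 𝓞 L)})).map (finAdelicCongr (↥(maximalRealSubfield L)) L (IsCMField.complexConj L) B ha hB).toMonoidHom) : Set ↥(finAdelic (↥(maximalRealSubfield L)) L (IsCMField.complexConj L) 3 H)) := by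
  rw [Subgroup.coe_map]
  exact (isCompact_finCongruenceLevel _ L _ 3 _ (span_factorial_ne_zero L m)).image (finAdelicCongr (↥(maximalRealSubfield L)) L (IsCMField.complexConj L) B ha hB).continuous

/-- `K_B((m+3)!)` is CLOSED (an open subgroup is closed). [cite: PlatonovRapinchuk1994, §5.1] -/
theorem isClosed_levelB (m : ℕ) :
    IsClosed (((finCongruenceLevel (↥(maximalRealSubfield L)) L (IsCMField.complexConj L) 3 (finSum 2 1 Jstar Jperp)
        (Ideal.span {(((m + 3).factorial : ℕ) : 𝓞 L)})).map (finAdelicCongr (↥(maximalRealSubfield L)) L (IsCMField.complexConj L) B ha hB).toMonoidHom) : Set ↥(finAdelic (↥(maximalRealSubfield L)) L (IsCMField.complexConj L) 3 H)) :=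
  Subgroup.isClosed_of_isOpen _ (isOpen_levelB L H Jstar Jperp B ha hB m)

/-- The family `m ↦ K_B((m+3)!)` is ANTITONE (`(m+3)! ∣ (m'+3)!` for `m ≤ m'`). [cite: PlatonovRapinchuk1994, §5.1] -/
theorem antitone_levelB :
    Antitone fun m : ℕ => ((finCongruenceLevel (↥(maximalRealSubfield L)) L (IsCMField.complexConj L) 3 (finSum 2 1 Jstar Jperp)
        (Ideal.span {(((m + 3).factorial : ℕ) : 𝓞 L)})).map (finAdelicCongr (↥(maximalRealSubfield L)) L (IsCMField.complexConj L) B ha hB).toMonoidHom) := by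
  intro m m' hmm'
  refine Subgroup.map_mono (finCongruenceLevel_mono (span_factorial_ne_zero L m') ?_)
  rw [Ideal.span_singleton_le_span_singleton]
  exact Nat.cast_dvd_cast (Nat.factorial_dvd_factorial (by omega))

/-- The family `K_B((m+3)!)` SHRINKS TO `1`: an element of every `K_B((m+3)!)` is `1` (★ `exists_finCongruenceLevel_span_subset`:
every neighbourhood of `1` contains an integer level `K(n)`, and `n ∣ (n+3)!`). [cite: PlatonovRapinchuk1994, §5.1] -/
theorem eq_one_of_forall_mem_levelB (g : ↥(finAdelic (↥(maximalRealSubfield L)) L (IsCMField.complexConj L) 3 H))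
    (hg : ∀ m : ℕ, g ∈ ((finCongruenceLevel (↥(maximalRealSubfield L)) L (IsCMField.complexConj L) 3 (finSum 2 1 Jstar Jperp)
        (Ideal.span {(((m + 3).factorial : ℕ) : 𝓞 L)})).map (finAdelicCongr (↥(maximalRealSubfield L)) L (IsCMField.complexConj L) B ha hB).toMonoidHom)) : g = 1 := by
  -- pull back along the congruence isomorphism
  set e := finAdelicCongr (↥(maximalRealSubfield L)) L (IsCMField.complexConj L) B ha hB with he
  set x := e.symm g with hx
  have hxmem : ∀ m : ℕ, x ∈ finCongruenceLevel (↥(maximalRealSubfield L)) L (IsCMField.complexConj L) 3 (finSum 2 1 Jstar Jperp)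
      (Ideal.span {(((m + 3).factorial : ℕ) : 𝓞 L)}) := by
    intro m
    obtain ⟨y, hy, hyg⟩ := Subgroup.mem_map.1 (hg m)
    have : x = y := by
      rw [hx, ← hyg]
      exact e.symm_apply_apply y
    rw [this]; exact hy
  suffices hx1 : x = 1 by
    have := congrArg e hx1
    rwa [hx, e.apply_symm_apply, map_one] at this
  haveI : T2Space (FiniteAdeleRing (𝓞 L) L) := inferInstanceAs <| T2Space
    (RestrictedProduct (fun v : HeightOneSpectrum (𝓞 L) => v.adicCompletion L)
      (fun v => (v.adicCompletionIntegers L : Set (v.adicCompletion L))) Filter.cofinite)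
  by_contra hx1
  have hU : ({x}ᶜ : Set _) ∈ 𝓝 (1 : ↥(finAdelic (↥(maximalRealSubfield L)) L (IsCMField.complexConj L) 3 (finSum 2 1 Jstar Jperp))) :=
    isOpen_compl_singleton.mem_nhds (fun h => hx1 (Set.mem_singleton_iff.1 h).symm)
  obtain ⟨n, hn, hsub⟩ := exists_finCongruenceLevel_span_subset hU
  have hle : finCongruenceLevel (↥(maximalRealSubfield L)) L (IsCMField.complexConj L) 3 (finSum 2 1 Jstar Jperp)
      (Ideal.span {(((n + 3).factorial : ℕ) : 𝓞 L)}) ≤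
      finCongruenceLevel (↥(maximalRealSubfield L)) L (IsCMField.complexConj L) 3 (finSum 2 1 Jstar Jperp)
      (Ideal.span {((n : ℕ) : 𝓞 L)}) := by
    refine finCongruenceLevel_mono (span_factorial_ne_zero L n) ?_
    rw [Ideal.span_singleton_le_span_singleton]
    exact Nat.cast_dvd_cast (Nat.dvd_factorial (Nat.pos_of_ne_zero hn) (by omega))
  exact hsub (hle (hxmem n)) rfl

/-! ### §9b. The cofinal corollary -/

/-- **[Del71] Prop. 1.15 for `U(W^⊥) ↪ U(V)` on `ℂ`-points — COFINAL FORM at the `B`-adapted principal levels.**  Granted the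
four routed inputs in their writers' shapes — (S1) finite double-coset representatives of `U(J⋆)(L⁺)∖U(J⋆)(𝔸_f)/K⋆` for compact
open `K⋆`; (S2) compact fundamental sets of the negative cone of `J⋆^τ` for `Γ⋆(K⋆; g)` modulo `ℂˣ`; (S3) finiteness of the
rational witnesses in `g·K·g′⁻¹` carrying one compact set of the sub-cone to meet `ℂˣ`·another; (F-A) the case-(A) closer at every
`B`-adapted principal level of depth `3 ≤ n` — there is `m₀` such that for every `m ≥ m₀` the embedding of Shimura sets
`Sh_{φGS⁻¹ K_B((m+3)!)}(U(J⋆),𝔻)(ℂ) → Sh_{K_B((m+3)!)}(U(H),𝔹²)(ℂ)` is INJECTIVE.  These trace pairs are cofinal among the levels of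
both groups, which is what road (ii)'s construction of the curve's canonical model inside the surface's (R2-2) consumes.
[cite: Deligne1971TravauxShimura, Prop. 1.15 + proof pp. 132–133] [cite: Milne2005ShimuraVarieties, Thm. 5.16 and Lemma 5.13 p. 57] -/
theorem ShimuraSetGS.embPoints_injective_cofinal
    (hanis : ∀ v : Fin 3 → L, hermForm (cmConjRingHom L) H v v = 0 → v = 0)
    (hpos : ∀ τ' : L →+* ℂ, InfinitePlace.mk τ' ≠ InfinitePlace.mk τ → (H.map τ').PosDef)
    {Tstar : GL (Fin 2) ℂ} (hTstar : formCongr (starRingEnd ℂ) Tstar (Jstar.map τ) = Matrix.diagonal ![(1 : ℂ), -1])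
    (hFA : ∀ n : ℕ, 3 ≤ n → ∀ (γ : rational (↥(maximalRealSubfield L)) L (IsCMField.complexConj L) 3 H) (u u' : ↥(finAdelic (↥(maximalRealSubfield L)) L (IsCMField.complexConj L) 2 Jstar)),
      (∀ x : Fin 2 → L, ∃ y : Fin 2 → L,
        ((γ : GL (Fin 3) L) : Matrix (Fin 3) (Fin 3) L) *ᵥ ((B : Matrix (Fin 3) (Fin 3) L) *ᵥ Fin.append x (0 : Fin 1 → L)) =
          (B : Matrix (Fin 3) (Fin 3) L) *ᵥ Fin.append y (0 : Fin 1 → L)) →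
      ((φGS L Jstar Jperp H B ha hB u)⁻¹ * (rationalToFinAdelic (↥(maximalRealSubfield L)) L (IsCMField.complexConj L) 3 H γ * φGS L Jstar Jperp H B ha hB u') : ↥(finAdelic (↥(maximalRealSubfield L)) L (IsCMField.complexConj L) 3 H)) ∈ ((finCongruenceLevel (↥(maximalRealSubfield L)) L (IsCMField.complexConj L) 3 (finSum 2 1 Jstar Jperp)
        (Ideal.span {((n : ℕ) : 𝓞 L)})).map (finAdelicCongr (↥(maximalRealSubfield L)) L (IsCMField.complexConj L) B ha hB).toMonoidHom) →
      ∃ γs : ↥(rational (↥(maximalRealSubfield L)) L (IsCMField.complexConj L) 2 Jstar), γ = embRational (↥(maximalRealSubfield L)) L (IsCMField.complexConj L) 2 1 Jstar Jperp H B ha hB γs) :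
    ∃ m₀ : ℕ, ∀ m, m₀ ≤ m → Function.Injective
      (ShimuraSetGS.embPoints L H τ T hT Jstar Jperp B ha hB hτa hτa'
        ((((finCongruenceLevel (↥(maximalRealSubfield L)) L (IsCMField.complexConj L) 3 (finSum 2 1 Jstar Jperp)
        (Ideal.span {(((m + 3).factorial : ℕ) : 𝓞 L)})).map (finAdelicCongr (↥(maximalRealSubfield L)) L (IsCMField.complexConj L) B ha hB).toMonoidHom)).comap (φGS L Jstar Jperp H B ha hB))
        ((finCongruenceLevel (↥(maximalRealSubfield L)) L (IsCMField.complexConj L) 3 (finSum 2 1 Jstar Jperp)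
        (Ideal.span {(((m + 3).factorial : ℕ) : 𝓞 L)})).map (finAdelicCongr (↥(maximalRealSubfield L)) L (IsCMField.complexConj L) B ha hB).toMonoidHom) (Subgroup.map_comap_le _ _)) := by
  classical
  -- the base trace level `K⋆₀ := φGS⁻¹ K_B(3!)`: compact (closed embedding) and open
  have hφ := isClosedEmbedding_φGS L Jstar Jperp H B ha hB
  have hK0c : IsCompact (((((finCongruenceLevel (↥(maximalRealSubfield L)) L (IsCMField.complexConj L) 3 (finSum 2 1 Jstar Jperp)
        (Ideal.span {(((0 + 3).factorial : ℕ) : 𝓞 L)})).map (finAdelicCongr (↥(maximalRealSubfield L)) L (IsCMField.complexConj L) B ha hB).toMonoidHom)).comap (φGS L Jstar Jperp H B ha hB) : Subgroup ↥(finAdelic (↥(maximalRealSubfield L)) L (IsCMField.complexConj L) 2 Jstar)) : Set ↥(finAdelic (↥(maximalRealSubfield L)) L (IsCMField.complexConj L) 2 Jstar)) := by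
    rw [Subgroup.coe_comap]
    exact hφ.isCompact_preimage (isCompact_levelB L H Jstar Jperp B ha hB 0)
  have hK0o : IsOpen (((((finCongruenceLevel (↥(maximalRealSubfield L)) L (IsCMField.complexConj L) 3 (finSum 2 1 Jstar Jperp)
        (Ideal.span {(((0 + 3).factorial : ℕ) : 𝓞 L)})).map (finAdelicCongr (↥(maximalRealSubfield L)) L (IsCMField.complexConj L) B ha hB).toMonoidHom)).comap (φGS L Jstar Jperp H B ha hB) : Subgroup ↥(finAdelic (↥(maximalRealSubfield L)) L (IsCMField.complexConj L) 2 Jstar)) : Set ↥(finAdelic (↥(maximalRealSubfield L)) L (IsCMField.complexConj L) 2 Jstar)) := by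
    rw [Subgroup.coe_comap]
    exact (isOpen_levelB L H Jstar Jperp B ha hB 0).preimage (continuous_φGS L Jstar Jperp H B ha hB)
  -- (S1) representatives, in the `hs` shape of §7
  obtain ⟨S, hS⟩ := exists_finset_doubleCoset_reps (L := L) (H := H) (Jstar := Jstar) (Jperp := Jperp) (B := B) (ha := ha)
    (hB := hB) hanis _ hK0o
  have hs : ∀ u : ↥(finAdelic (↥(maximalRealSubfield L)) L (IsCMField.complexConj L) 2 Jstar), ∃ γs : ↥(rational (↥(maximalRealSubfield L)) L (IsCMField.complexConj L) 2 Jstar), ∃ g ∈ S,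
      g⁻¹ * (rationalToFinAdelic (↥(maximalRealSubfield L)) L (IsCMField.complexConj L) 2 Jstar γs * u) ∈ (((finCongruenceLevel (↥(maximalRealSubfield L)) L (IsCMField.complexConj L) 3 (finSum 2 1 Jstar Jperp)
        (Ideal.span {(((0 + 3).factorial : ℕ) : 𝓞 L)})).map (finAdelicCongr (↥(maximalRealSubfield L)) L (IsCMField.complexConj L) B ha hB).toMonoidHom)).comap (φGS L Jstar Jperp H B ha hB) := by
    intro u
    obtain ⟨γ, s, hsS, k, hk, hu⟩ := hS u
    refine ⟨γ⁻¹, s, hsS, ?_⟩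
    have : s⁻¹ * (rationalToFinAdelic (↥(maximalRealSubfield L)) L (IsCMField.complexConj L) 2 Jstar γ⁻¹ * u) = k := by rw [hu, map_inv]; group
    rw [this]; exact hk
  -- (S2) fundamental sets, one per representative
  have hanisStar : ∀ x : Fin 2 → L, hermForm (cmConjRingHom L) Jstar x x = 0 → x = 0 :=
    anisotropic_of_frame (L := L) (H := H) (Jstar := Jstar) (Jperp := Jperp) (B := B) (ha := ha) (hB := hB) hanis
  have hS2 : ∀ g : ↥(finAdelic (↥(maximalRealSubfield L)) L (IsCMField.complexConj L) 2 Jstar), ∃ F ⊆ negCone (Jstar.map τ), IsCompact F ∧ ∀ v ∈ negCone (Jstar.map τ),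
      ∃ δ : ↥(rational (↥(maximalRealSubfield L)) L (IsCMField.complexConj L) 2 Jstar),
        g⁻¹ * (rationalToFinAdelic (↥(maximalRealSubfield L)) L (IsCMField.complexConj L) 2 Jstar δ * g) ∈
          (((finCongruenceLevel (↥(maximalRealSubfield L)) L (IsCMField.complexConj L) 3 (finSum 2 1 Jstar Jperp)
            (Ideal.span {(((0 + 3).factorial : ℕ) : 𝓞 L)})).map (finAdelicCongr (↥(maximalRealSubfield L)) L
              (IsCMField.complexConj L) B ha hB).toMonoidHom).comap (φGS L Jstar Jperp H B ha hB)) ∧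
        ∃ c : ℂ, c ≠ 0 ∧ c • (((ratToGLℂ L Jstar τ δ : GL (Fin 2) ℂ) : Matrix (Fin 2) (Fin 2) ℂ) *ᵥ v) ∈ F :=
    fun g => exists_isCompact_negCone_fundamental_conj L Jstar τ hanisStar hTstar _ hK0o g
  choose F hFsub hFc hFfund using hS2
  -- §8 with the concrete family
  obtain ⟨i₁, hi₁⟩ := ShimuraSetGS.embPoints_injective_eventually L H τ T hT Jstar Jperp B ha hB hτa hτa'
    (fun m : ℕ => ((finCongruenceLevel (↥(maximalRealSubfield L)) L (IsCMField.complexConj L) 3 (finSum 2 1 Jstar Jperp)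
        (Ideal.span {(((m + 3).factorial : ℕ) : 𝓞 L)})).map (finAdelicCongr (↥(maximalRealSubfield L)) L (IsCMField.complexConj L) B ha hB).toMonoidHom))
    (fun m => isClosed_levelB L H Jstar Jperp B ha hB m) (antitone_levelB L H Jstar Jperp B ha hB)
    (fun g hg => eq_one_of_forall_mem_levelB L H Jstar Jperp B ha hB g hg) 0 _ hK0c (Subgroup.map_comap_le _ _) S hs F
    (fun g _ => hFfund g)
    (fun g _ g' _ => finite_setOf_witness_meeting (L := L) (H := H) (τ := τ) (T := T) (hT := hT) (Jstar := Jstar) (Jperp := Jperp)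
      (B := B) (hB := hB) (hτa := hτa) (hτa' := hτa') hpos (hFc g) (hFc g') (hFsub g) (hFsub g') _ _ _
      (isCompact_levelB L H Jstar Jperp B ha hB 0))
    (fun m _ γ u u' hst hco => hFA ((m + 3).factorial) ((Nat.le_add_left 3 m).trans (Nat.self_le_factorial _)) γ u u' hst hco)
  exact ⟨i₁, fun m hm => hi₁ m hm _ (Subgroup.map_comap_le _ _) le_rfl⟩

/-- **The «all admissible levels below the threshold» form** (road (ii) assembly shape, A-p10 2026-08-29T04:53Z «Q1-bis»): with the
same inputs, but the case-(A) closer granted at EVERY level `K ≤ K_B(n)` (`3 ≤ n`; exactly the `hK` binder of (F-A)'s head), there is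
`m₀` such that for EVERY level `T ≤ K_B((m₀+3)!)` of `U(H)(𝔸_f)` and every level `K⋆` of `U(J⋆)(𝔸_f)` squeezed by the trace condition
(`φGS(K⋆) ≤ T`, `T ∩ im φGS ⊆ φGS(K⋆)`), `embPoints : Sh_{K⋆}(U(J⋆),𝔻)(ℂ) → Sh_T(U(H),𝔹²)(ℂ)` is INJECTIVE — a coincidence witness
at `T` is one at `K_B((m₀+3)!) ⊇ T`, so case (B) transfers from the principal family.  The threshold `m₀` is EXISTENTIAL (it bounds the
finitely many CM self-intersections of the special curve at the base level); nothing here places `n = 3` below it.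
[cite: Deligne1971TravauxShimura, Prop. 1.15 + proof pp. 132–133 («pour K² assez petit»)] [cite: Milne2005ShimuraVarieties, Thm. 5.16] -/
theorem ShimuraSetGS.embPoints_injective_of_le_levelB
    (hanis : ∀ v : Fin 3 → L, hermForm (cmConjRingHom L) H v v = 0 → v = 0)
    (hpos : ∀ τ' : L →+* ℂ, InfinitePlace.mk τ' ≠ InfinitePlace.mk τ → (H.map τ').PosDef)
    {Tstar : GL (Fin 2) ℂ} (hTstar : formCongr (starRingEnd ℂ) Tstar (Jstar.map τ) = Matrix.diagonal ![(1 : ℂ), -1])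
    (hFA : ∀ n : ℕ, 3 ≤ n → ∀ K : Subgroup ↥(finAdelic (↥(maximalRealSubfield L)) L (IsCMField.complexConj L) 3 H), K ≤ ((finCongruenceLevel (↥(maximalRealSubfield L)) L (IsCMField.complexConj L) 3 (finSum 2 1 Jstar Jperp)
        (Ideal.span {((n : ℕ) : 𝓞 L)})).map (finAdelicCongr (↥(maximalRealSubfield L)) L (IsCMField.complexConj L) B ha hB).toMonoidHom) →
      ∀ (γ : rational (↥(maximalRealSubfield L)) L (IsCMField.complexConj L) 3 H) (u u' : ↥(finAdelic (↥(maximalRealSubfield L)) L (IsCMField.complexConj L) 2 Jstar)),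
      (∀ x : Fin 2 → L, ∃ y : Fin 2 → L,
        ((γ : GL (Fin 3) L) : Matrix (Fin 3) (Fin 3) L) *ᵥ ((B : Matrix (Fin 3) (Fin 3) L) *ᵥ Fin.append x (0 : Fin 1 → L)) =
          (B : Matrix (Fin 3) (Fin 3) L) *ᵥ Fin.append y (0 : Fin 1 → L)) →
      ((φGS L Jstar Jperp H B ha hB u)⁻¹ * (rationalToFinAdelic (↥(maximalRealSubfield L)) L (IsCMField.complexConj L) 3 H γ * φGS L Jstar Jperp H B ha hB u') : ↥(finAdelic (↥(maximalRealSubfield L)) L (IsCMField.complexConj L) 3 H)) ∈ K →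
      ∃ γs : ↥(rational (↥(maximalRealSubfield L)) L (IsCMField.complexConj L) 2 Jstar), γ = embRational (↥(maximalRealSubfield L)) L (IsCMField.complexConj L) 2 1 Jstar Jperp H B ha hB γs) :
    ∃ m₀ : ℕ, ∀ Tlev : Subgroup ↥(finAdelic (↥(maximalRealSubfield L)) L (IsCMField.complexConj L) 3 H), Tlev ≤ ((finCongruenceLevel (↥(maximalRealSubfield L)) L (IsCMField.complexConj L) 3 (finSum 2 1 Jstar Jperp)
        (Ideal.span {(((m₀ + 3).factorial : ℕ) : 𝓞 L)})).map (finAdelicCongr (↥(maximalRealSubfield L)) L (IsCMField.complexConj L) B ha hB).toMonoidHom) →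
      ∀ (Kstar : Subgroup ↥(finAdelic (↥(maximalRealSubfield L)) L (IsCMField.complexConj L) 2 Jstar)) (hK : Kstar.map (φGS L Jstar Jperp H B ha hB) ≤ Tlev), Tlev.comap (φGS L Jstar Jperp H B ha hB) ≤ Kstar →
      Function.Injective (ShimuraSetGS.embPoints L H τ T hT Jstar Jperp B ha hB hτa hτa' Kstar Tlev hK) := by
  classical
  have hφ := isClosedEmbedding_φGS L Jstar Jperp H B ha hB
  have hK0c : IsCompact (((((finCongruenceLevel (↥(maximalRealSubfield L)) L (IsCMField.complexConj L) 3 (finSum 2 1 Jstar Jperp)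
        (Ideal.span {(((0 + 3).factorial : ℕ) : 𝓞 L)})).map (finAdelicCongr (↥(maximalRealSubfield L)) L (IsCMField.complexConj L) B ha hB).toMonoidHom)).comap (φGS L Jstar Jperp H B ha hB) : Subgroup ↥(finAdelic (↥(maximalRealSubfield L)) L (IsCMField.complexConj L) 2 Jstar)) : Set ↥(finAdelic (↥(maximalRealSubfield L)) L (IsCMField.complexConj L) 2 Jstar)) := by
    rw [Subgroup.coe_comap]
    exact hφ.isCompact_preimage (isCompact_levelB L H Jstar Jperp B ha hB 0)
  have hK0o : IsOpen (((((finCongruenceLevel (↥(maximalRealSubfield L)) L (IsCMField.complexConj L) 3 (finSum 2 1 Jstar Jperp)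
        (Ideal.span {(((0 + 3).factorial : ℕ) : 𝓞 L)})).map (finAdelicCongr (↥(maximalRealSubfield L)) L (IsCMField.complexConj L) B ha hB).toMonoidHom)).comap (φGS L Jstar Jperp H B ha hB) : Subgroup ↥(finAdelic (↥(maximalRealSubfield L)) L (IsCMField.complexConj L) 2 Jstar)) : Set ↥(finAdelic (↥(maximalRealSubfield L)) L (IsCMField.complexConj L) 2 Jstar)) := by
    rw [Subgroup.coe_comap]
    exact (isOpen_levelB L H Jstar Jperp B ha hB 0).preimage (continuous_φGS L Jstar Jperp H B ha hB)
  obtain ⟨S, hS⟩ := exists_finset_doubleCoset_reps (L := L) (H := H) (Jstar := Jstar) (Jperp := Jperp) (B := B) (ha := ha)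
    (hB := hB) hanis _ hK0o
  have hs : ∀ u : ↥(finAdelic (↥(maximalRealSubfield L)) L (IsCMField.complexConj L) 2 Jstar), ∃ γs : ↥(rational (↥(maximalRealSubfield L)) L (IsCMField.complexConj L) 2 Jstar), ∃ g ∈ S,
      g⁻¹ * (rationalToFinAdelic (↥(maximalRealSubfield L)) L (IsCMField.complexConj L) 2 Jstar γs * u) ∈ (((finCongruenceLevel (↥(maximalRealSubfield L)) L (IsCMField.complexConj L) 3 (finSum 2 1 Jstar Jperp)
        (Ideal.span {(((0 + 3).factorial : ℕ) : 𝓞 L)})).map (finAdelicCongr (↥(maximalRealSubfield L)) L (IsCMField.complexConj L) B ha hB).toMonoidHom)).comap (φGS L Jstar Jperp H B ha hB) := by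
    intro u
    obtain ⟨γ, s, hsS, k, hk, hu⟩ := hS u
    refine ⟨γ⁻¹, s, hsS, ?_⟩
    have : s⁻¹ * (rationalToFinAdelic (↥(maximalRealSubfield L)) L (IsCMField.complexConj L) 2 Jstar γ⁻¹ * u) = k := by rw [hu, map_inv]; group
    rw [this]; exact hk
  have hanisStar : ∀ x : Fin 2 → L, hermForm (cmConjRingHom L) Jstar x x = 0 → x = 0 :=
    anisotropic_of_frame (L := L) (H := H) (Jstar := Jstar) (Jperp := Jperp) (B := B) (ha := ha) (hB := hB) hanis
  have hS2 : ∀ g : ↥(finAdelic (↥(maximalRealSubfield L)) L (IsCMField.complexConj L) 2 Jstar), ∃ F ⊆ negCone (Jstar.map τ), IsCompact F ∧ ∀ v ∈ negCone (Jstar.map τ),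
      ∃ δ : ↥(rational (↥(maximalRealSubfield L)) L (IsCMField.complexConj L) 2 Jstar),
        g⁻¹ * (rationalToFinAdelic (↥(maximalRealSubfield L)) L (IsCMField.complexConj L) 2 Jstar δ * g) ∈
          (((finCongruenceLevel (↥(maximalRealSubfield L)) L (IsCMField.complexConj L) 3 (finSum 2 1 Jstar Jperp)
            (Ideal.span {(((0 + 3).factorial : ℕ) : 𝓞 L)})).map (finAdelicCongr (↥(maximalRealSubfield L)) L
              (IsCMField.complexConj L) B ha hB).toMonoidHom).comap (φGS L Jstar Jperp H B ha hB)) ∧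
        ∃ c : ℂ, c ≠ 0 ∧ c • (((ratToGLℂ L Jstar τ δ : GL (Fin 2) ℂ) : Matrix (Fin 2) (Fin 2) ℂ) *ᵥ v) ∈ F :=
    fun g => exists_isCompact_negCone_fundamental_conj L Jstar τ hanisStar hTstar _ hK0o g
  choose F hFsub hFc hFfund using hS2
  -- the finite reduction and case (B) at depth for the principal family
  obtain ⟨E, A, C, hE, hA, hC, hAC, hEbad, hred⟩ := exists_finite_reduction L H τ Jstar Jperp B ha hB
    (fun m : ℕ => ((finCongruenceLevel (↥(maximalRealSubfield L)) L (IsCMField.complexConj L) 3 (finSum 2 1 Jstar Jperp)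
        (Ideal.span {(((m + 3).factorial : ℕ) : 𝓞 L)})).map (finAdelicCongr (↥(maximalRealSubfield L)) L (IsCMField.complexConj L) B ha hB).toMonoidHom)) (antitone_levelB L H Jstar Jperp B ha hB) 0 _ hK0c
    (Subgroup.map_comap_le _ _) S hs F (fun g _ => hFfund g)
    (fun g _ g' _ => finite_setOf_witness_meeting (L := L) (H := H) (τ := τ) (T := T) (hT := hT) (Jstar := Jstar) (Jperp := Jperp)
      (B := B) (hB := hB) (hτa := hτa) (hτa' := hτa') hpos (hFc g) (hFc g') (hFsub g) (hFsub g') _ _ _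
      (isCompact_levelB L H Jstar Jperp B ha hB 0))
  obtain ⟨m₁, hm₁⟩ := forall_witness_mapsTo_frame_eventually L H τ Jstar Jperp B ha hB
    (fun m : ℕ => ((finCongruenceLevel (↥(maximalRealSubfield L)) L (IsCMField.complexConj L) 3 (finSum 2 1 Jstar Jperp)
        (Ideal.span {(((m + 3).factorial : ℕ) : 𝓞 L)})).map (finAdelicCongr (↥(maximalRealSubfield L)) L (IsCMField.complexConj L) B ha hB).toMonoidHom))
    (fun m => isClosed_levelB L H Jstar Jperp B ha hB m) (antitone_levelB L H Jstar Jperp B ha hB)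
    (fun g hg => eq_one_of_forall_mem_levelB L H Jstar Jperp B ha hB g hg) hA hC hAC hE hEbad 0 hred
  refine ⟨m₁, fun Tlev hTlev Kstar hK hKc' => ?_⟩
  refine ShimuraSetGS.embPoints_injective_of_witnesses L H τ T hT Jstar Jperp B ha hB hτa hτa' Kstar Tlev hK hKc' ?_ ?_
  · -- case (B): a witness at `Tlev ≤ K_B((m₁+3)!)` is a witness at `K_B((m₁+3)!)`
    intro γ v v' hv hv' u u' hball hcoset
    exact hm₁ m₁ le_rfl γ v v' hv hv' u u' hball (hTlev hcoset)
  · -- case (A): (F-A) at `Tlev ≤ K_B((m₁+3)!)`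
    intro γ u u' hst hco
    exact hFA ((m₁ + 3).factorial) ((Nat.le_add_left 3 m₁).trans (Nat.self_le_factorial _)) Tlev hTlev γ u u' hst hco

end Cofinal

end UnitaryCanonicalModel

end Literature.AlgebraicGeometry.ShimuraVarieties

end
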